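import Mathlib
import HarnessLib
import Summits.NavierStokesRegularity.NavierStokesRegularity.Theorems.IsobarTomographyTubeAlternativeStubPeakZoomPatch
import Summits.NavierStokesRegularity.NavierStokesRegularity.Theorems.IsobarTomographyTubeAlternativeStubTwoSidedVorticityRate
import Summits.NavierStokesRegularity.NavierStokesRegularity.Theorems.SqueezeCycleExtremalBiaxialitySubcriticalPayerTomography
import Summits.NavierStokesRegularity.NavierStokesRegularity.Theorems.IsobarTomographyBlobRiccatiClosureStubLimsupTimes
import Summits.NavierStokesRegularity.NavierStokesRegularity.Theorems.IsobarTomographyBlobRiccatiClosureStubArgmaxSlice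
import Summits.NavierStokesRegularity.NavierStokesRegularity.Theorems.IsobarTomographyBlobRiccatiClosureApexZoomTools
import Summits.NavierStokesRegularity.NavierStokesRegularity.Theorems.IsobarTomographyBlobRiccatiClosureStubHessianCentreLimit
import Summits.NavierStokesRegularity.NavierStokesRegularity.Theorems.IsobarTomographyBlobRiccatiClosureApexZoomBundle

/-!
# Crux `IsobarTomography.BlobRiccatiClosure` (stmt-NavierStokesRegularity-11740), line
# `type-i-apex-liouville`, stub B `stub_apexZoom` — the extremal-apex zoom under Type I

Helper file (theorems only) `--supports` the item; it proves the registered stub B of the line.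

**Statement** (`stub_apexZoom`). Let `(u, p)` be a MAXIMAL classical solution of unforced
Navier–Stokes (viscosity `ν > 0`) on `ℝ³ × [0, T)`, Leray–Hopf from its rapidly decaying datum,
blowing up at the Type-I rate, and satisfying the BLOB HYPOTHESIS with `(κ, Ω, t₀)`: for
`t ∈ [t₀, T)` the peak set `{‖ω(t,·)‖ > Ω(t)}` is non-empty and on it `κ‖ω‖²Δp ≤ D²p[ω, ω]`. Then
there is a Type-I ancient mild field `W` (KNSS/Oseen gauge, `IsTypeIAncientMild C W`) with a
classical pressure `q` on `(−∞, 0)` and a time `σ < 0` such that `‖curl W(σ, 0)‖ = 1`, the point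
`(σ, 0)` is an APEX — `(−s)‖curl W(s, y)‖ ≤ −σ` for all `s < 0`, `y`, i.e. a global space–time
maximiser of the scale-invariant vorticity —, and the blob inequality holds at `(σ, 0)`.

**Proof.** (1) Two-sided vorticity rate (`stub_twoSidedVorticityRate`): the gauge
`m(t) = (T − t) sup_x ‖ω(t, x)‖` lies in `[c, C]` on `[t₂, T)`, `t₂ = max t₀ t₁`, `c > 0`.
(2) Limsup times (B1 `stub_limsupTimes`): `G := limsup_{t→T⁻} m ∈ [c, C]`, times `t_k → T` with
`m(t_k) → G`, and `m ≤ G + ε` near `T`; global argmaxes `x_k` (B3 `stub_argmaxSlice`), which lie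
in the non-empty peak set, so blob holds at `(t_k, x_k)`. (3) Zooms at the EXTREMAL level with
FIXED zoom time: `w_k(s, y) = c_k u(T + c_k²ν s, x_k + c_kν y)`, `q_k = c_k² p ∘ Φ_k`,
`c_k²ν = (T − t_k)/G`, so the slice `t_k` sits at `s = σ := −G` for every `k`; the zoom kit
(`zoom_isClassical`, `zoom_oseen`, `zoom_norm_le`) makes them classical unit-viscosity Oseen-mild
fields on windows `(A_k, 0)`, `A_k → −∞`, with a common Type-I bound. (4) KNSS compactness
(`exists_tendsto_of_typeI_seq_Ioo`) gives a Type-I ancient mild limit `W` of a subsequence, with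
gradients converging pointwise at every negative time, and a classical pressure `q_W`
(`exists_isClassicalNSSolutionOn_Iio_of_isTypeIAncientMild`). (5) Centre:
`curl w_k(σ, 0) = (c_k²ν) ω(t_k, x_k)` has norm `m(t_k)/G → 1` and converges to `curl W(σ, 0)`.
Apex: for `s < 0` the physical time `t' = T + c_k²ν s → T` and
`(−s)‖curl w_k(s, y)‖ = (T − t')‖ω(t', ·)‖ ≤ m(t') ≤ G + ε` eventually. (6) Blob at the centre:
scale-exact for `(w_k, q_k)` (`blob_smul_stPull_slice`); `Δq = −tr(∇w)²` converges with the
gradients; the pressure Hessians converge on the diagonal by B2 (`stub_hessianCentreLimit`, fed by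
the bundles B5 `stub_windowTomographyBundle` / `exists_ancientTomographyBundle` with `k`-uniform
window constants `exists_norm_iteratedFDeriv_le_of_typeI_Ioo`, `exists_lipschitz_time_of_typeI_Ioo`)
and at the moving vorticity vectors by B4 (`stub_hessianApplyLimit`).

References: G. Koch, N. Nadirashvili, G. Seregin, V. Šverák, Acta Math. 203 (2009) 83–105 =
arXiv:0709.3599, Prop. 4.1, Lemma 6.1, proof of Thm 6.2 [KochNadirashviliSereginSverak2009];
Y. Giga, P.-Y. Hsu, Y. Maekawa, arXiv:1310.6471 §4 (the Type-I blow-up argument at extremal points);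
D. Gilbarg, N. Trudinger, Lemma 4.2 [GilbargTrudinger2001] (behind B2).
-/

noncomputable section

open Set Filter Topology Function MeasureTheory Metric
open scoped RealInnerProductSpace NNReal ContDiff

-- the summit and its single sub-problem share the name (CONVENTIONS §1), as in every Theorems file
set_option linter.dupNamespace false

-- nested operator types `ℝ³ →L[ℝ] ℝ³ →L[ℝ] ℝ`
set_option maxSynthPendingDepth 4

namespace Summit.NavierStokesRegularity.NavierStokesRegularity.Theorems.BlobRiccatiClosure.TypeIApexLiouville

open Literature.Analysis Literature.Analysis.FluidPDE
open Summit.NavierStokesRegularity.NavierStokesRegularity.Theorems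
open Summit.NavierStokesRegularity.NavierStokesRegularity.Theorems.TubeAlternative.AnalyticPropagation

/-! ### The extremal-apex zoom -/

set_option maxHeartbeats 800000 in
/-- **Stub B `stub_apexZoom` (line `type-i-apex-liouville` of crux `IsobarTomography.BlobRiccatiClosure`):
the extremal-apex zoom under Type I.** Let `(u, p)` be a maximal classical solution on `[0, T)`,
Leray–Hopf from its rapidly decaying datum, blowing up at the Type-I rate, and satisfying the blob
hypothesis with `(κ, Ω, t₀)`. Then there is a Type-I ancient mild field `W` (`IsTypeIAncientMild C W`)
with a classical pressure `q` on `(−∞, 0)` and a time `σ < 0` such that `‖curl W(σ, 0)‖ = 1`,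
`(−s)‖curl W(s, y)‖ ≤ −σ` for all `s < 0`, `y` (the point `(σ, 0)` is an APEX: a global space–time
maximiser of the scale-invariant vorticity), and the blob inequality holds at `(σ, 0)`.
Proof: module docstring. [cite: KochNadirashviliSereginSverak2009, Lemma 6.1 and Prop. 4.1 (arXiv:0709.3599 pp. 8, 11–13)] -/
theorem stub_apexZoom :
    ∀ (ν T : ℝ), 0 < ν → 0 < T → ∀ (u : ℝ → EuclideanSpace ℝ (Fin 3) → EuclideanSpace ℝ (Fin 3)) (p : ℝ → EuclideanSpace ℝ (Fin 3) → ℝ),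
      IsMaximalSmoothSolution ν 0 u p T → IsLerayHopfOn T ν 0 (u 0) u →
      HasRapidSpatialDecay (u 0) → IsTypeIBlowup u T →
      ∀ (κ : ℝ) (Ω : ℝ → ℝ) (t₀ : ℝ), 0 < κ → t₀ ∈ Ico 0 T →
      (∀ t ∈ Ico t₀ T, (∃ x : EuclideanSpace ℝ (Fin 3), Ω t < ‖curl (u t) x‖) ∧
        ∀ x : EuclideanSpace ℝ (Fin 3), Ω t < ‖curl (u t) x‖ →
          κ * ‖curl (u t) x‖ ^ 2 * Laplacian.laplacian (p t) x ≤
            iteratedFDeriv ℝ 2 (p t) x ![curl (u t) x, curl (u t) x]) →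
      ∃ (C : ℝ) (W : ℝ → EuclideanSpace ℝ (Fin 3) → EuclideanSpace ℝ (Fin 3)) (q : ℝ → EuclideanSpace ℝ (Fin 3) → ℝ) (σ : ℝ),
        IsTypeIAncientMild C W ∧ IsClassicalNSSolutionOn (Iio 0) 1 0 W q ∧ σ < 0 ∧
        ‖curl (W σ) 0‖ = 1 ∧ (∀ s < 0, ∀ y : EuclideanSpace ℝ (Fin 3), (-s) * ‖curl (W s) y‖ ≤ -σ) ∧
        κ * ‖curl (W σ) 0‖ ^ 2 * Laplacian.laplacian (q σ) 0 ≤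
          iteratedFDeriv ℝ 2 (q σ) 0 ![curl (W σ) 0, curl (W σ) 0] := by
  intro ν T hν hT u p hmax hLH hdec hI κ Ω t₀ _hκ ht₀ hH
  have hsol := hmax.1
  obtain ⟨C₀, δ, hδ, hδT, hrw⟩ := exists_typeI_window_bound hT hI
  -- ## Step 1: the two-sided vorticity rate and the gauge `m(t) = (T - t) sup‖ω(t)‖`
  obtain ⟨c, C, hc, t₁, ht₁, hrate⟩ := stub_twoSidedVorticityRate ν T hν hT u p hmax hLH hdec hI
  set t₂ : ℝ := max t₀ t₁ with ht₂
  have ht₂T : t₂ < T := max_lt ht₀.2 ht₁.2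
  have ht₂0 : 0 ≤ t₂ := ht₀.1.trans (le_max_left _ _)
  have hI₀ : ∀ {t}, t ∈ Ico t₂ T → t ∈ Ico t₀ T := fun ht => ⟨(le_max_left _ _).trans ht.1, ht.2⟩
  have hI₁ : ∀ {t}, t ∈ Ico t₂ T → t ∈ Ico t₁ T := fun ht => ⟨(le_max_right _ _).trans ht.1, ht.2⟩
  have hIT : ∀ {t}, t ∈ Ico t₂ T → t ∈ Ico 0 T := fun ht => ⟨ht₂0.trans ht.1, ht.2⟩
  have hbdd : ∀ t ∈ Ico t₂ T, BddAbove (range fun x => ‖curl (u t) x‖) := fun t ht =>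
    ⟨C / (T - t), forall_mem_range.2 fun x => (hrate t (hI₁ ht)).2 x⟩
  set m : ℝ → ℝ := fun t => (T - t) * ⨆ x, ‖curl (u t) x‖ with hm
  have hmb : ∀ t ∈ Ico t₂ T, c ≤ m t ∧ m t ≤ C := by
    intro t ht
    have hTt : 0 < T - t := sub_pos.2 ht.2
    obtain ⟨x, hx⟩ := (hrate t (hI₁ ht)).1
    have h1 : c / (T - t) ≤ ⨆ y, ‖curl (u t) y‖ := hx.trans (le_ciSup (hbdd t ht) x)
    have h2 : (⨆ y, ‖curl (u t) y‖) ≤ C / (T - t) := ciSup_le fun y => (hrate t (hI₁ ht)).2 y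
    rw [div_le_iff₀ hTt] at h1
    rw [le_div_iff₀ hTt] at h2
    exact ⟨by simp only [hm]; linarith, by simp only [hm]; linarith⟩
  -- ## Step 2: limsup times (B1) and global argmaxes (B3)
  obtain ⟨G, hcG, _hGC, ⟨tk, htk, htend, hmlim⟩, hGup⟩ :=
    stub_limsupTimes m c C t₂ T ht₂T hmb
  have hG : 0 < G := hc.trans_le hcG
  have hpos : ∀ k, ∃ x, 0 < ‖curl (u (tk k)) x‖ := fun k => by
    obtain ⟨x, hx⟩ := (hrate (tk k) (hI₁ (htk k))).1
    exact ⟨x, lt_of_lt_of_le (div_pos hc (sub_pos.2 (htk k).2)) hx⟩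
  choose xk hxk using
    fun k => stub_argmaxSlice ν T u p hν hT hsol hLH hdec (tk k) (hIT (htk k)) (hpos k)
  set Ωk : ℕ → ℝ := fun k => ‖curl (u (tk k)) (xk k)‖ with hΩk
  have hΩpos : ∀ k, 0 < Ωk k := fun k => by
    obtain ⟨x, hx⟩ := hpos k
    exact hx.trans_le (hxk k x)
  have hsup : ∀ k, (⨆ x, ‖curl (u (tk k)) x‖) = Ωk k := fun k =>
    le_antisymm (ciSup_le fun x => hxk k x) (le_ciSup (hbdd _ (htk k)) (xk k))
  have hmk : ∀ k, m (tk k) = (T - tk k) * Ωk k := fun k => by simp only [hm, hsup]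
  have hTtk : ∀ k, 0 < T - tk k := fun k => sub_pos.2 (htk k).2
  have hblobk : ∀ k, κ * ‖curl (u (tk k)) (xk k)‖ ^ 2 * Laplacian.laplacian (p (tk k)) (xk k) ≤
      iteratedFDeriv ℝ 2 (p (tk k)) (xk k) ![curl (u (tk k)) (xk k), curl (u (tk k)) (xk k)] :=
    fun k => by
    obtain ⟨⟨x, hx⟩, hball⟩ := hH (tk k) (hI₀ (htk k))
    exact hball (xk k) (hx.trans_le (hxk k x))
  -- ## Step 3: the zooms `w_k(s, y) = c_k u(T + c_k²ν s, x_k + c_kν y)`, `c_k²ν = (T - t_k)/G`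
  set cz : ℕ → ℝ := fun k => Real.sqrt ((T - tk k) / (G * ν)) with hcz
  have hcz2 : ∀ k, cz k ^ 2 * ν = (T - tk k) / G := fun k => by
    simp only [hcz]
    rw [Real.sq_sqrt (by have := hTtk k; positivity)]
    field_simp
  have hczpos : ∀ k, 0 < cz k := fun k =>
    Real.sqrt_pos.2 (by have := hTtk k; positivity)
  have hα : (1 : ℝ) = ν / ν := (div_self hν.ne').symm
  have hβ : ν = ν ^ 2 / ν := by field_simp
  set w : ℕ → ℝ → EuclideanSpace ℝ (Fin 3) → EuclideanSpace ℝ (Fin 3) := fun k =>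
    (cz k * 1) • stPull (cz k ^ 2 * ν) (cz k * ν) T (xk k) u with hw
  set qz : ℕ → ℝ → EuclideanSpace ℝ (Fin 3) → ℝ := fun k =>
    (cz k * 1) ^ 2 • stPull (cz k ^ 2 * ν) (cz k * ν) T (xk k) p with hqz
  set A : ℕ → ℝ := fun k => -(δ / (cz k ^ 2 * ν)) with hAdef
  have hclw : ∀ k, IsClassicalNSSolutionOn (Ioo (A k) 0) 1 0 (w k) (qz k) := fun k =>
    zoom_isClassical hν hsol hν hα hβ (hczpos k) hδT
  have hcw : ∀ k, ContinuousOn (uncurry (w k)) (Ioo (A k) 0 ×ˢ univ) := fun k =>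
    zoom_continuousOn hν hsol hν hα hβ (hczpos k) hδT
  have hdivw : ∀ k, ∀ s ∈ Ioo (A k) 0, IsWeaklyDivFree (w k s) := fun k s hs =>
    zoom_isWeaklyDivFree hν hsol hν hα hβ (hczpos k) hδT hs
  have hmildw : ∀ k, ∀ s s' : ℝ, A k < s → s < s' → s' < 0 → ∀ y,
      w k s' y = UnboundedOperators.heatExtension (w k s) (s' - s) y -
        oseenDuhamel 1 s (w k) (w k) s' y :=
    fun k s s' hs hss' hs' y => zoom_oseen hν hT hsol hLH hdec hν hα hβ (hczpos k) hδT hs hss' hs' y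
  set C₁ : ℝ := 1 * C₀ / Real.sqrt ν with hC₁
  have hIw : ∀ k, ∀ s ∈ Ioo (A k) 0, ∀ y, ‖w k s y‖ ≤ C₁ / Real.sqrt (-s) :=
    fun k s hs y => zoom_norm_le hν hα hβ hν (hczpos k) hδT hrw hs y
  set σ : ℝ := -G with hσdef
  have hσ0 : σ < 0 := by simp only [hσdef]; linarith
  have hTσ : ∀ k, T + cz k ^ 2 * ν * σ = tk k := fun k => by
    rw [hcz2]; simp only [hσdef]; field_simp; ring
  have hphys : ∀ s : ℝ, Tendsto (fun k => T + cz k ^ 2 * ν * s) atTop (𝓝 T) := by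
    intro s
    have h1 : Tendsto (fun k => T - tk k) atTop (𝓝 (T - T)) := tendsto_const_nhds.sub htend
    rw [sub_self] at h1
    have h2 : Tendsto (fun k => T + (T - tk k) / G * s) atTop (𝓝 (T + 0 / G * s)) :=
      tendsto_const_nhds.add ((h1.div_const G).mul_const s)
    simp only [zero_div, zero_mul, add_zero] at h2
    exact h2.congr fun k => by rw [hcz2]
  have hAlim : Tendsto A atTop atBot := by
    have h1 : Tendsto (fun k => T - tk k) atTop (𝓝[>] 0) := by
      refine tendsto_nhdsWithin_iff.2 ⟨?_, Eventually.of_forall fun k => hTtk k⟩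
      simpa using (tendsto_const_nhds (x := T)).sub htend
    have h2 : Tendsto (fun k => δ * G * (T - tk k)⁻¹) atTop atTop :=
      (tendsto_inv_nhdsGT_zero.comp h1).const_mul_atTop (mul_pos hδ hG)
    have h3 : A = fun k => -(δ * G * (T - tk k)⁻¹) := by
      funext k
      simp only [hAdef, hcz2]
      field_simp
    rw [h3]
    exact tendsto_neg_atTop_atBot.comp h2
  -- ## Step 4: compactness (KNSS) and the classical pressure of the limit
  obtain ⟨φ, hφ, W, hWclass, _hpt, hptG, -, -⟩ := exists_tendsto_of_typeI_seq_Ioo C₁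
    (w := w) hAlim hcw hdivw hmildw hIw
  obtain ⟨qW, hWcl⟩ := exists_isClassicalNSSolutionOn_Iio_of_isTypeIAncientMild hWclass
  have hφt : Tendsto φ atTop atTop := hφ.tendsto_atTop
  have hdu : ∀ k, Differentiable ℝ (u (T + cz k ^ 2 * ν * σ)) := fun k => by
    rw [hTσ]; exact (hsol.contDiff_velocity (hIT (htk k))).differentiable (by simp)
  have hdp : ∀ k, ContDiff ℝ 2 (p (T + cz k ^ 2 * ν * σ)) := fun k => by
    rw [hTσ]; exact (hsol.contDiff_pressure (hIT (htk k))).of_le (by norm_cast)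
  have hcurlk : ∀ k, curl (w k σ) 0 = (cz k ^ 2 * ν) • curl (u (tk k)) (xk k) := fun k => by
    have h := curl_smul_stPull_slice (a := cz k * 1) (β' := cz k ^ 2 * ν) (γ := cz k * ν) (T := T)
      (x₀ := xk k) (u := u) (s := σ) (hdu k) 0
    rw [smul_zero, add_zero, hTσ] at h
    rw [show w k σ = ((cz k * 1) • stPull (cz k ^ 2 * ν) (cz k * ν) T (xk k) u) σ from rfl, h,
      show cz k * 1 * (cz k * ν) = cz k ^ 2 * ν by ring]
  have hnormk : ∀ k, ‖curl (w k σ) 0‖ = m (tk k) / G := fun k => by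
    rw [hcurlk, norm_smul, Real.norm_eq_abs, abs_of_pos (by have := hczpos k; positivity), hcz2,
      hmk]
    simp only [hΩk]
    ring
  have hcurl_lim : Tendsto (fun j => curl (w (φ j) σ) 0) atTop (𝓝 (curl (W σ) 0)) := by
    have h := (curlCLM.continuous.tendsto _).comp (hptG σ hσ0 0)
    simpa only [Function.comp_def, ← curl_eq_curlCLM] using h
  have hnorm1 : ‖curl (W σ) 0‖ = 1 := by
    have h1 : Tendsto (fun j => ‖curl (w (φ j) σ) 0‖) atTop (𝓝 1) := by
      have h2 : Tendsto (fun j => m (tk (φ j)) / G) atTop (𝓝 (G / G)) :=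
        (hmlim.comp hφt).div_const G
      rw [div_self hG.ne'] at h2
      exact h2.congr fun j => (hnormk (φ j)).symm
    exact tendsto_nhds_unique hcurl_lim.norm h1
  refine ⟨C₁, W, qW, σ, hWclass, hWcl, hσ0, hnorm1, ?_, ?_⟩
  · -- ## Step 5: the apex property
    intro s hs y
    refine le_of_forall_pos_le_add fun ε hε => ?_
    obtain ⟨T', hT'T, hT'⟩ := hGup ε hε
    have hlim : Tendsto (fun j => (-s) * ‖curl (w (φ j) s) y‖) atTop
        (𝓝 ((-s) * ‖curl (W s) y‖)) := by
      have h := (curlCLM.continuous.tendsto _).comp (hptG s hs y)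
      have h' : Tendsto (fun j => curl (w (φ j) s) y) atTop (𝓝 (curl (W s) y)) := by
        simpa only [Function.comp_def, ← curl_eq_curlCLM] using h
      exact h'.norm.const_mul _
    refine le_of_tendsto hlim ?_
    have hev1 : ∀ᶠ j in atTop, T' < T + cz (φ j) ^ 2 * ν * s :=
      ((hphys s).comp hφt).eventually (lt_mem_nhds hT'T)
    have hev2 : ∀ᶠ j in atTop, t₂ < T + cz (φ j) ^ 2 * ν * s :=
      ((hphys s).comp hφt).eventually (lt_mem_nhds ht₂T)
    filter_upwards [hev1, hev2] with j hj1 hj2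
    set k := φ j with hk
    set t' : ℝ := T + cz k ^ 2 * ν * s with ht'
    have ht'T : t' < T := by
      have : cz k ^ 2 * ν * s < 0 := mul_neg_of_pos_of_neg (by have := hczpos k; positivity) hs
      simp only [ht']; linarith
    have ht'I : t' ∈ Ico t₂ T := ⟨hj2.le, ht'T⟩
    have hdu' : Differentiable ℝ (u (T + cz k ^ 2 * ν * s)) :=
      (hsol.contDiff_velocity (hIT ht'I)).differentiable (by simp)
    have hcurl : curl (w k s) y = (cz k ^ 2 * ν) • curl (u t') (xk k + (cz k * ν) • y) := by
      have h := curl_smul_stPull_slice (a := cz k * 1) (β' := cz k ^ 2 * ν) (γ := cz k * ν)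
        (T := T) (x₀ := xk k) (u := u) (s := s) hdu' y
      rw [show w k s = ((cz k * 1) • stPull (cz k ^ 2 * ν) (cz k * ν) T (xk k) u) s from rfl, h,
        show cz k * 1 * (cz k * ν) = cz k ^ 2 * ν by ring]
    have hTt' : T - t' = (-s) * (cz k ^ 2 * ν) := by simp only [ht']; ring
    have hsupb : ‖curl (u t') (xk k + (cz k * ν) • y)‖ ≤ ⨆ x, ‖curl (u t') x‖ :=
      le_ciSup (hbdd t' ht'I) _
    calc (-s) * ‖curl (w k s) y‖
        = (T - t') * ‖curl (u t') (xk k + (cz k * ν) • y)‖ := by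
          rw [hcurl, norm_smul, Real.norm_eq_abs, abs_of_pos (by have := hczpos k; positivity),
            hTt']
          ring
      _ ≤ m t' := by
          simp only [hm]
          exact mul_le_mul_of_nonneg_left hsupb (sub_pos.2 ht'T).le
      _ ≤ G + ε := hT' t' ⟨hj1, ht'T⟩
      _ = -σ + ε := by simp only [hσdef, neg_neg]
  · -- ## Step 6: the blob inequality at the centre passes to the limit
    -- (a) windows and `k`-uniform bounds at the fixed zoom time `σ`
    set a' : ℝ := σ - 2 with ha'
    set b' : ℝ := σ / 2 with hb'
    have hab : a' - 1 < b' := by simp only [ha', hb']; linarith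
    have hb'0 : b' < 0 := by simp only [hb']; linarith
    have hσwin : σ ∈ Ioo a' b' := ⟨by simp only [ha']; linarith, by simp only [hb']; linarith⟩
    obtain ⟨K₀, hK₀⟩ := exists_norm_iteratedFDeriv_le_of_typeI_Ioo C₁ 0 hab hb'0 one_pos
    obtain ⟨K₁, hK₁⟩ := exists_norm_iteratedFDeriv_le_of_typeI_Ioo C₁ 1 hab hb'0 one_pos
    obtain ⟨K₂, hK₂⟩ := exists_norm_iteratedFDeriv_le_of_typeI_Ioo C₁ 2 hab hb'0 one_pos
    obtain ⟨K₃, hK₃⟩ := exists_norm_iteratedFDeriv_le_of_typeI_Ioo C₁ 3 hab hb'0 one_pos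
    obtain ⟨L, hL0, hL⟩ := exists_lipschitz_time_of_typeI_Ioo C₁ 0 hab hb'0 one_pos
    have hwin : ∀ {s}, s ∈ Ioo a' b' → s ∈ Ico (a' - 1 + 1) b' := fun hs =>
      ⟨by linarith [hs.1], hs.2⟩
    have hev : ∀ᶠ j in atTop, A (φ j) < a' - 1 :=
      (hAlim.comp hφt).eventually (eventually_lt_atBot _)
    set Tr : ℝ := ‖(traceCLM : (EuclideanSpace ℝ (Fin 3) →L[ℝ] EuclideanSpace ℝ (Fin 3)) →L[ℝ] ℝ)‖
      with hTr
    set Bm : ℝ := max (max (max K₀ K₁) (max K₂ K₃)) 0 with hBm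
    obtain ⟨M', M₁', B', S', L', hV4, hVdiv, hQ4, hVM', hVM₁', hQΔ, hQB', hVS', hVL'⟩ :=
      exists_ancientTomographyBundle hWclass hWcl hσ0
    set Ms : ℝ := max K₀ M' with hMs
    set M₁s : ℝ := max K₁ M₁' with hM₁s
    set Bs : ℝ := max (3 * K₂ + K₁ * K₀ + L) B' with hBs
    set Ss : ℝ := max (Tr * ((1 + Tr) * (2 ^ (0 + 1) * Bm ^ 2))) S' with hSs
    set Ls : ℝ := max (Tr * ((1 + Tr) * (2 ^ (1 + 1) * Bm ^ 2))) L' with hLs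
    -- (c) the hypotheses of B2 along the subsequence, eventually (B5 at the window time `σ`)
    have hevAll : ∀ᶠ j in atTop, ContDiff ℝ 4 (w (φ j) σ) ∧
        VectorCalculus.IsDivFree (w (φ j) σ) ∧ ContDiff ℝ 4 (qz (φ j) σ) ∧
        (∀ y, ‖w (φ j) σ y‖ ≤ Ms) ∧ (∀ y, ‖fderiv ℝ (w (φ j) σ) y‖ ≤ M₁s) ∧
        (∀ y, Laplacian.laplacian (qz (φ j) σ) y =
          -VectorCalculus.divergence (convect (w (φ j) σ) (w (φ j) σ)) y) ∧
        (∀ y, ‖fderiv ℝ (qz (φ j) σ) y‖ ≤ Bs) ∧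
        (∀ y, ‖VectorCalculus.divergence (convect (w (φ j) σ) (w (φ j) σ)) y‖ ≤ Ss) ∧
        (∀ y, ‖fderiv ℝ (VectorCalculus.divergence (convect (w (φ j) σ) (w (φ j) σ))) y‖ ≤
          Ls) := by
      filter_upwards [hev] with j hj
      set k := φ j with hk
      have hσS : σ ∈ Ioo (A k) 0 := ⟨by linarith [hσwin.1], hσ0⟩
      have h0 : ∀ y, ‖w k σ y‖ ≤ K₀ := fun y => by
        simpa [norm_iteratedFDeriv_zero] using
          hK₀ hj (hcw k) (hdivw k) (hmildw k) (hIw k) σ (hwin hσwin) y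
      have h1 : ∀ y, ‖fderiv ℝ (w k σ) y‖ ≤ K₁ := fun y => by
        simpa [norm_iteratedFDeriv_one] using
          hK₁ hj (hcw k) (hdivw k) (hmildw k) (hIw k) σ (hwin hσwin) y
      have h2 : ∀ y, ‖iteratedFDeriv ℝ 2 (w k σ) y‖ ≤ K₂ := fun y =>
        hK₂ hj (hcw k) (hdivw k) (hmildw k) (hIw k) σ (hwin hσwin) y
      have h3 : ∀ y, ‖iteratedFDeriv ℝ 3 (w k σ) y‖ ≤ K₃ := fun y =>
        hK₃ hj (hcw k) (hdivw k) (hmildw k) (hIw k) σ (hwin hσwin) y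
      have hLj : ∀ s ∈ Ioo a' b', ∀ t ∈ Ioo a' b', ∀ y,
          ‖w k t y - w k s y‖ ≤ L * |t - s| := by
        intro s hs t ht y
        have h := hL hj (hcw k) (hdivw k) (hmildw k) (hIw k) s (hwin hs) t (hwin ht) y
        rwa [FluidPDE.norm_iteratedFDeriv_zero_sub] at h
      have hLt : ∀ y, ‖deriv (fun s => w k s y) σ‖ ≤ L := fun y =>
        norm_deriv_timeLine_le isOpen_Ioo (hclw k).smooth_velocity hL0 hLj hσwin hσS y
      obtain ⟨h4, hdivk, hq4, hΔ, hB, hS, hLs⟩ :=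
        stub_windowTomographyBundle (A k) σ K₀ K₁ K₂ K₃ L (w k) (qz k) (hclw k) hσS h0 h1 h2 h3 hLt
      exact ⟨h4, hdivk, hq4, fun y => (h0 y).trans (le_max_left _ _),
        fun y => (h1 y).trans (le_max_left _ _), hΔ, fun y => (hB y).trans (le_max_left _ _),
        fun y => (hS y).trans (le_max_left _ _), fun y => (hLs y).trans (le_max_left _ _)⟩
    have hσI : σ ∈ Iio 0 := hσ0
    have hVM : ∀ y, ‖W σ y‖ ≤ Ms := fun y => (hVM' y).trans (le_max_right _ _)
    have hVM₁ : ∀ y, ‖fderiv ℝ (W σ) y‖ ≤ M₁s := fun y => (hVM₁' y).trans (le_max_right _ _)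
    have hQB : ∀ y, ‖fderiv ℝ (qW σ) y‖ ≤ Bs := fun y => (hQB' y).trans (le_max_right _ _)
    have hVS : ∀ y, ‖VectorCalculus.divergence (convect (W σ) (W σ)) y‖ ≤ Ss := fun y =>
      (hVS' y).trans (le_max_right _ _)
    have hVL : ∀ y, ‖fderiv ℝ (VectorCalculus.divergence (convect (W σ) (W σ))) y‖ ≤ Ls :=
      fun y => (hVL' y).trans (le_max_right _ _)
    have hgrad : ∀ y, Tendsto (fun j => fderiv ℝ (w (φ j) σ) y) atTop (𝓝 (fderiv ℝ (W σ) y)) :=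
      fun y => hptG σ hσ0 y
    -- (e) B2: the pressure Hessians converge at the centre, on the diagonal
    have hdiag : ∀ e, Tendsto (fun j => fderiv ℝ (fderiv ℝ (qz (φ j) σ)) 0 e e) atTop
        (𝓝 (fderiv ℝ (fderiv ℝ (qW σ)) 0 e e)) := fun e =>
      stub_hessianCentreLimit (fun j => w (φ j) σ) (fun j => qz (φ j) σ) (W σ) (qW σ)
        Ms M₁s Bs Ss Ls 0 e hevAll hV4 hVdiv hQ4 hVM hVM₁ hQΔ hQB hVS hVL hgrad
    -- (f) B4: the quadratic forms at the moving vorticity vectors converge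
    have hqz2 : ∀ k, ContDiff ℝ 2 (qz k σ) := fun k => by
      have h : ContDiff ℝ 2 fun y : EuclideanSpace ℝ (Fin 3) =>
          (cz k * 1) ^ 2 • p (T + cz k ^ 2 * ν * σ) (xk k + (cz k * ν) • y) :=
        ((hdp k).comp (contDiff_const.add (contDiff_id.const_smul (cz k * ν)))).const_smul
          ((cz k * 1) ^ 2)
      exact h
    have hQ2 : ContDiff ℝ 2 (qW σ) := hQ4.of_le (by norm_cast)
    have hquad : Tendsto (fun j => fderiv ℝ (fderiv ℝ (qz (φ j) σ)) 0
        (curl (w (φ j) σ) 0) (curl (w (φ j) σ) 0)) atTop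
        (𝓝 (fderiv ℝ (fderiv ℝ (qW σ)) 0 (curl (W σ) 0) (curl (W σ) 0))) :=
      stub_hessianApplyLimit (fun j => fderiv ℝ (fderiv ℝ (qz (φ j) σ)) 0)
        (fderiv ℝ (fderiv ℝ (qW σ)) 0) (fun j => curl (w (φ j) σ) 0) (curl (W σ) 0)
        (fun j v v' => hessian_symm (hqz2 (φ j)) 0 v v') (fun v v' => hessian_symm hQ2 0 v v')
        hdiag hcurl_lim
    have hRHS : Tendsto (fun j => iteratedFDeriv ℝ 2 (qz (φ j) σ) 0
        ![curl (w (φ j) σ) 0, curl (w (φ j) σ) 0]) atTop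
        (𝓝 (iteratedFDeriv ℝ 2 (qW σ) 0 ![curl (W σ) 0, curl (W σ) 0])) := by
      simp only [iteratedFDeriv_two_apply, Matrix.cons_val_zero, Matrix.cons_val_one]
      exact hquad
    -- (g) the Laplacians at the centre converge (`Δq = -tr(∇w)²`)
    have hΔW : Laplacian.laplacian (qW σ) 0 =
        -traceCLM ((fderiv ℝ (W σ) 0).comp (fderiv ℝ (W σ) 0)) :=
      laplacian_pressure_eq_neg_trace isOpen_Iio hWcl hσI 0
    have hΔk : ∀ᶠ j in atTop, Laplacian.laplacian (qz (φ j) σ) 0 =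
        -traceCLM ((fderiv ℝ (w (φ j) σ) 0).comp (fderiv ℝ (w (φ j) σ) 0)) := by
      filter_upwards [hev] with j hj
      have hσS : σ ∈ Ioo (A (φ j)) 0 := ⟨by linarith [hσwin.1], hσ0⟩
      exact laplacian_pressure_eq_neg_trace isOpen_Ioo (hclw _) hσS 0
    have hΔlim : Tendsto (fun j => Laplacian.laplacian (qz (φ j) σ) 0) atTop
        (𝓝 (Laplacian.laplacian (qW σ) 0)) := by
      have h1 := hptG σ hσ0 0
      have hcomp : Continuous fun P : (EuclideanSpace ℝ (Fin 3) →L[ℝ] EuclideanSpace ℝ (Fin 3)) ×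
          (EuclideanSpace ℝ (Fin 3) →L[ℝ] EuclideanSpace ℝ (Fin 3)) => P.1.comp P.2 :=
        (ContinuousLinearMap.compL ℝ (EuclideanSpace ℝ (Fin 3)) (EuclideanSpace ℝ (Fin 3))
          (EuclideanSpace ℝ (Fin 3))).continuous₂
      have h2 := (hcomp.tendsto _).comp (h1.prodMk_nhds h1)
      have h3 := (((traceCLM : (EuclideanSpace ℝ (Fin 3) →L[ℝ] EuclideanSpace ℝ (Fin 3)) →L[ℝ]
        ℝ).continuous.tendsto _).comp h2).neg
      rw [hΔW]
      refine h3.congr' ?_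
      filter_upwards [hΔk] with j hj
      rw [hj]
      rfl
    have hLHS : Tendsto (fun j => κ * ‖curl (w (φ j) σ) 0‖ ^ 2 *
        Laplacian.laplacian (qz (φ j) σ) 0) atTop
        (𝓝 (κ * ‖curl (W σ) 0‖ ^ 2 * Laplacian.laplacian (qW σ) 0)) :=
      ((hcurl_lim.norm.pow 2).const_mul κ).mul hΔlim
    -- (h) the blob inequality for every zoom (scale-exact), and the limit
    have hblobz : ∀ k, κ * ‖curl (w k σ) 0‖ ^ 2 * Laplacian.laplacian (qz k σ) 0 ≤
        iteratedFDeriv ℝ 2 (qz k σ) 0 ![curl (w k σ) 0, curl (w k σ) 0] := fun k => by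
      refine blob_smul_stPull_slice (hdu k) (hdp k) 0 ?_
      simpa only [hTσ, smul_zero, add_zero] using hblobk k
    exact le_of_tendsto_of_tendsto hLHS hRHS (Eventually.of_forall fun j => hblobz (φ j))

end Summit.NavierStokesRegularity.NavierStokesRegularity.Theorems.BlobRiccatiClosure.TypeIApexLiouville

end
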